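import Summits.ResolutionOfSingularities.ResolutionOfSingularities.Theorems.FrobeniusLadderFInjectiveMacaulayficationGradedChartClauseAssembly
import Summits.ResolutionOfSingularities.ResolutionOfSingularities.Theorems.FrobeniusLadderFInjectiveMacaulayficationFiniteGradedDescentAt
import HarnessLib

/-!
# The G4 assembly core — POINTWISE form (engine v2 «off orbits», brick (b))
# (crux `FInjectiveMacaulayfication` stmt-ResolutionOfSingularities-15315; RULING R15.48 (3) of res-L1-w45a-plan-1)

Support file (helper), chain w45a, seat res-L1-w45a-stub-4 g6. [OURS · L1 W4.5a; pointwise variant of res-L1-w45a-lead-1's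
`GradedChartClauseAssembly.chartClause_core` / `chartClause_core_affine`] — NOT a statement of the manuscript; AI-written, weaker than
expert review.

`GradedChartClauseAssembly.chartClause_core` (data: `B ⊇ A' ≅ T₀[Y, Y⁻¹]` via `e`, retraction `ρ`, `b ∈ B` with `b^N ∈ A'`,
`ι : C₀ ≃+* T₀`, `u₀ ∈ C₀` with `e⁻¹(b^N) ∈ (ι u₀ / 1)`; `Q ∋ u₀` a maximal ideal of `C₀`) concludes the clause at `(C₀)_Q` from the clause of
`B` at EVERY maximal ideal `P ∋ b`.  Its proof (finite graded descent at `𝔫' = e(ι(Q)·T₀[Y] + (Y − 1))`, transport, Laurent descent,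
transport) consumes the clause of `B` only at the maximal ideals `P` lying OVER `𝔫'`, all of which lie over `Q` along the composite ring
map `φ : C₀ → T₀ → T₀[Y] → T₀[Y, Y⁻¹] → A' → B`.  **`chartClause_core_at`** asks the clause of `B_P` only for the maximal `P ∋ b` with
`φ(Q) ⊆ P` («`P` lies over the chart point `Q`») — the hypothesis an «off finitely many cone orbits» engine can supply — using brick (a)
`FiniteGradedDescentAt.clause_at_of_retract_of_over`; `chartClause_core_affine_at` is the affine-domain form (uniform dimension from
`exists_ringKrullDim_eq_and_trdeg_eq`).  Bodies = the tree's, with the one descent line changed.  No definitions, no named facts. [folklore]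
-/

-- single-problem summit: the doubled namespace component is forced
set_option linter.dupNamespace false

noncomputable section

namespace Summit.ResolutionOfSingularities.ResolutionOfSingularities.Theorems.FInjectiveMacaulayfication.ChartClauseCoreAt

open IsLocalRing Polynomial
open Summit.ResolutionOfSingularities.ResolutionOfSingularities.Theorems.FInjectiveMacaulayfication

/-- **ABSTRACT CORE of the G4 assembly, POINTWISE in the chart point.** As `GradedChartClauseAssembly.chartClause_core`, but the clause
of `B` is assumed only at the maximal ideals `P ∋ b` lying over the chart point `Q` along `φ = (· : A' → B) ∘ e ∘ (C · / 1) ∘ ι`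
(`∀ x ∈ Q, φ x ∈ P`). [folklore] -/
theorem chartClause_core_at (p : ℕ) [Fact p.Prime] (k : Type) [Field k] (B : Type) [CommRing B] [Algebra k B]
    [IsNoetherianRing B] [CharP B p] (m : ℕ)
    (hdimB : ∀ (P : Ideal B) [P.IsMaximal], ringKrullDim (Localization.AtPrime P) = m)
    (A' : Subalgebra k B) [Algebra.IsIntegral A' B] (ρ : B →ₗ[A'] A') (hρ : ∀ x : A', ρ (x : B) = x)
    (b : B) (N : ℕ) (hbN : b ^ N ∈ A')
    (C₀ : Type) [CommRing C₀] (T₀ : Type) [CommRing T₀] [IsNoetherianRing T₀] [CharP T₀ p] (ι : C₀ ≃+* T₀)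
    (e : Localization.Away (Polynomial.X : Polynomial T₀) ≃+* A') (u₀ : C₀)
    (heN : e.symm ⟨b ^ N, hbN⟩ ∈ Ideal.span {algebraMap (Polynomial T₀)
      (Localization.Away (Polynomial.X : Polynomial T₀)) (Polynomial.C (ι u₀))})
    (Q : Ideal C₀) [Q.IsMaximal] (huQ : u₀ ∈ Q)
    (hclB : ∀ (P : Ideal B) [P.IsMaximal], b ∈ P →
      (∀ x : C₀, x ∈ Q → ((e (algebraMap (Polynomial T₀) (Localization.Away (Polynomial.X : Polynomial T₀))
        (Polynomial.C (ι x))) : A') : B) ∈ P) →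
      ∀ d : ℕ, ringKrullDim (Localization.AtPrime P) = d → ∀ s : Fin d → Localization.AtPrime P,
      (Ideal.span (Set.range s)).radical.IsMaximal →
        RingTheory.Sequence.IsWeaklyRegular (Localization.AtPrime P) (List.ofFn s) ∧
        ∀ y : Localization.AtPrime P, (∃ e : ℕ, y ^ p ^ e ∈ Ideal.span
          ((fun z : Localization.AtPrime P => z ^ p ^ e) ''
            (Ideal.span (Set.range s) : Set (Localization.AtPrime P)))) → y ∈ Ideal.span (Set.range s)) :
    ∀ d : ℕ, ringKrullDim (Localization.AtPrime Q) = d → ∀ s : Fin d → Localization.AtPrime Q,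
      (Ideal.span (Set.range s)).radical.IsMaximal →
        RingTheory.Sequence.IsWeaklyRegular (Localization.AtPrime Q) (List.ofFn s) ∧
        ∀ y : Localization.AtPrime Q, (∃ e : ℕ, y ^ p ^ e ∈ Ideal.span
          ((fun z : Localization.AtPrime Q => z ^ p ^ e) ''
            (Ideal.span (Set.range s) : Set (Localization.AtPrime Q)))) → y ∈ Ideal.span (Set.range s) := by
  have hdimA : ∀ (𝔫 : Ideal A') [𝔫.IsMaximal], ringKrullDim (Localization.AtPrime 𝔫) = m :=
    IntegralSubalgebraLocalDim.stub_integralSubalgebraLocalDim k B A' m hdimB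
  -- `𝔫₀ = ι(Q)`, `𝔑 = 𝔫₀·T₀[Y] + (Y − 1)`, `𝔐 = 𝔑·T₀[Y, Y⁻¹]`, `𝔫' = e(𝔐)`
  obtain ⟨𝔫₀, h𝔫₀⟩ : ∃ 𝔫₀ : Ideal T₀, 𝔫₀ = Q.comap ι.symm := ⟨_, rfl⟩
  haveI : 𝔫₀.IsMaximal := by rw [h𝔫₀]; exact Ideal.comap_isMaximal_of_equiv ι.symm
  have hmem₀ : ∀ x, ι x ∈ 𝔫₀ ↔ x ∈ Q := fun x => by
    rw [h𝔫₀, Ideal.mem_comap, RingEquiv.symm_apply_apply]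
  have hmem₀' : ∀ y, ι.symm y ∈ Q ↔ y ∈ 𝔫₀ := fun y => by
    rw [h𝔫₀, Ideal.mem_comap]
  obtain ⟨𝔑, h𝔑⟩ : ∃ 𝔑 : Ideal (Polynomial T₀),
      𝔑 = 𝔫₀.map (Polynomial.C : T₀ →+* Polynomial T₀) ⊔ Ideal.span {(Polynomial.X - 1 : Polynomial T₀)} := ⟨_, rfl⟩
  obtain ⟨𝔐, h𝔐⟩ : ∃ 𝔐 : Ideal (Localization.Away (Polynomial.X : Polynomial T₀)),
      𝔐 = 𝔑.map (algebraMap (Polynomial T₀) (Localization.Away (Polynomial.X : Polynomial T₀))) := ⟨_, rfl⟩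
  haveI : 𝔐.IsMaximal := by rw [h𝔐]; exact LaurentDescentAway.isMaximal_map_away 𝔫₀ 𝔑 h𝔑
  have h𝔐c : 𝔐.comap (algebraMap (Polynomial T₀) (Localization.Away (Polynomial.X : Polynomial T₀))) = 𝔑 := by
    rw [h𝔐]; exact LaurentDescentAway.comap_map_away 𝔫₀ 𝔑 h𝔑
  obtain ⟨𝔫', h𝔫'⟩ : ∃ 𝔫' : Ideal A', 𝔫' = 𝔐.comap e.symm := ⟨_, rfl⟩
  haveI : 𝔫'.IsMaximal := by rw [h𝔫']; exact Ideal.comap_isMaximal_of_equiv e.symm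
  have hmem' : ∀ x, e.symm x ∈ 𝔐 ↔ x ∈ 𝔫' := fun x => by
    rw [h𝔫', Ideal.mem_comap]
  -- `φ(x) ∈ 𝔫'` for `x ∈ Q`
  have hφ : ∀ x : C₀, x ∈ Q →
      e (algebraMap (Polynomial T₀) (Localization.Away (Polynomial.X : Polynomial T₀)) (Polynomial.C (ι x))) ∈ 𝔫' := by
    intro x hx
    refine (hmem' _).mp ?_
    rw [RingEquiv.symm_apply_apply]
    refine (LaurentDescentAway.algebraMap_mem_iff_of_comap_eq 𝔑 𝔐 h𝔐c _).mpr ?_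
    have h1 : Polynomial.C (ι x) ∈
        𝔫₀.map (Polynomial.C : T₀ →+* Polynomial T₀) ⊔ Ideal.span {(Polynomial.X - 1 : Polynomial T₀)} :=
      Ideal.mem_sup_left (Ideal.mem_map_of_mem _ ((hmem₀ _).mpr hx))
    rwa [← h𝔑] at h1
  -- `b^N ∈ 𝔫'`: `e⁻¹(b^N) ∈ (C(ι u₀)/1) ⊆ 𝔐`
  have hmem : (⟨b ^ N, hbN⟩ : A') ∈ 𝔫' := by
    refine (hmem' _).mp ((Ideal.span_singleton_le_iff_mem _).mpr ?_ heN)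
    have h := (hmem' _).mpr (hφ u₀ huQ)
    rwa [RingEquiv.symm_apply_apply] at h
  -- finite graded descent AT `𝔫'`: the maximal `P` of `B` over `𝔫'` contain `b` and lie over `Q`
  have h1 := FiniteGradedDescentAt.clause_at_of_retract_of_over p k B A' ρ hρ m hdimB hdimA 𝔫' (fun P _ hP => by
    have hbP : b ∈ P := by
      have h2 : algebraMap A' B ⟨b ^ N, hbN⟩ ∈ P := by rw [← Ideal.mem_comap, hP]; exact hmem
      exact Ideal.IsPrime.mem_of_pow_mem inferInstance N h2
    refine hclB P hbP fun x hx => ?_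
    have h3 : algebraMap A' B (e (algebraMap (Polynomial T₀) (Localization.Away (Polynomial.X : Polynomial T₀))
        (Polynomial.C (ι x)))) ∈ P := by
      rw [← Ideal.mem_comap, hP]; exact hφ x hx
    exact h3)
  -- clause for `A'_{𝔫'}` ⇒ for `T₀[Y, Y⁻¹]_𝔐` ⇒ for `(T₀)_{𝔫₀}` ⇒ for `(C₀)_Q`
  have h2 := GradedChartClauseAssembly.clause_atPrime_of_ringEquiv p e.symm 𝔫' 𝔐 hmem' h1
  have h3 := LaurentDescentAway.laurentDescentAway p T₀ 𝔫₀ 𝔐 (h𝔐c.trans h𝔑) h2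
  exact GradedChartClauseAssembly.clause_atPrime_of_ringEquiv p ι.symm 𝔫₀ Q hmem₀' h3

/-- **ABSTRACT CORE, affine-domain form, POINTWISE** (`chartClause_core_affine` with the pointwise hypothesis of `chartClause_core_at`):
for a DOMAIN `B` of finite type over the field `k` the uniform dimension hypothesis is automatic
(`exists_ringKrullDim_eq_and_trdeg_eq` + `ringKrullDim_localization_atPrime_eq_of_isMaximal`). [folklore] -/
theorem chartClause_core_affine_at (p : ℕ) [Fact p.Prime] (k : Type) [Field k] (B : Type) [CommRing B] [IsDomain B] [Algebra k B]
    [Algebra.FiniteType k B] [CharP B p]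
    (A' : Subalgebra k B) [Algebra.IsIntegral A' B] (ρ : B →ₗ[A'] A') (hρ : ∀ x : A', ρ (x : B) = x)
    (b : B) (N : ℕ) (hbN : b ^ N ∈ A')
    (C₀ : Type) [CommRing C₀] (T₀ : Type) [CommRing T₀] [IsNoetherianRing T₀] [CharP T₀ p] (ι : C₀ ≃+* T₀)
    (e : Localization.Away (Polynomial.X : Polynomial T₀) ≃+* A') (u₀ : C₀)
    (heN : e.symm ⟨b ^ N, hbN⟩ ∈ Ideal.span {algebraMap (Polynomial T₀)
      (Localization.Away (Polynomial.X : Polynomial T₀)) (Polynomial.C (ι u₀))})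
    (Q : Ideal C₀) [Q.IsMaximal] (huQ : u₀ ∈ Q)
    (hclB : ∀ (P : Ideal B) [P.IsMaximal], b ∈ P →
      (∀ x : C₀, x ∈ Q → ((e (algebraMap (Polynomial T₀) (Localization.Away (Polynomial.X : Polynomial T₀))
        (Polynomial.C (ι x))) : A') : B) ∈ P) →
      ∀ d : ℕ, ringKrullDim (Localization.AtPrime P) = d → ∀ s : Fin d → Localization.AtPrime P,
      (Ideal.span (Set.range s)).radical.IsMaximal →
        RingTheory.Sequence.IsWeaklyRegular (Localization.AtPrime P) (List.ofFn s) ∧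
        ∀ y : Localization.AtPrime P, (∃ e : ℕ, y ^ p ^ e ∈ Ideal.span
          ((fun z : Localization.AtPrime P => z ^ p ^ e) ''
            (Ideal.span (Set.range s) : Set (Localization.AtPrime P)))) → y ∈ Ideal.span (Set.range s)) :
    ∀ d : ℕ, ringKrullDim (Localization.AtPrime Q) = d → ∀ s : Fin d → Localization.AtPrime Q,
      (Ideal.span (Set.range s)).radical.IsMaximal →
        RingTheory.Sequence.IsWeaklyRegular (Localization.AtPrime Q) (List.ofFn s) ∧
        ∀ y : Localization.AtPrime Q, (∃ e : ℕ, y ^ p ^ e ∈ Ideal.span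
          ((fun z : Localization.AtPrime Q => z ^ p ^ e) ''
            (Ideal.span (Set.range s) : Set (Localization.AtPrime Q)))) → y ∈ Ideal.span (Set.range s) := by
  haveI : IsNoetherianRing B := Algebra.FiniteType.isNoetherianRing k B
  obtain ⟨m, hm, -⟩ := Literature.AlgebraicGeometry.Resolution.exists_ringKrullDim_eq_and_trdeg_eq k B
  have hdimB : ∀ (P : Ideal B) [P.IsMaximal], ringKrullDim (Localization.AtPrime P) = m := fun P _ => by
    rw [Literature.AlgebraicGeometry.Resolution.ringKrullDim_localization_atPrime_eq_of_isMaximal k P, hm]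
  exact chartClause_core_at p k B m hdimB A' ρ hρ b N hbN C₀ T₀ ι e u₀ heN Q huQ hclB

end Summit.ResolutionOfSingularities.ResolutionOfSingularities.Theorems.FInjectiveMacaulayfication.ChartClauseCoreAt

end
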